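import Literature.NumberTheory.IwasawaTheory.FukudaPElementaryInclusion
import Literature.NumberTheory.IwasawaTheory.FukudaPHilbertInclusion
import Literature.NumberTheory.IwasawaTheory.ClassicalMuInvariant
import HarnessLib

/-!
# Fukuda 1994, Theorem 1 (2) at finite level — the PER-LAYER class-field-theoretic data: for `K_n ⊆ K_{n+j} ⊆ K_{n+t} ⊆ H_p`,
# `[Gal(H_p/K_{n+j}) : N_j] = p^{e_{n+j}}` and `[Gal(H_p/K_{n+j}) : N_j·G_j^p] = p^{r_{n+j}}`

Topic `NumberTheory/IwasawaTheory` (namespace = path). THEOREM-ONLY file (no definition, no named fact, no `sorry`), written by the prover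
seat `bsd-potss-k8t-c4` g20 (cell `bsd-potss`; Fukuda road of stmt-BirchSwinnertonDyer-19982; closes nothing). One layer of the assembly of the
finite-level proof of `fukuda1994_thm1_classGroupPRank_const_of_succ_eq` (`ClassicalMuInvariant.lean` §5), split off from the main file
`Fukuda1994Thm1RankProofs.lean` to keep each elaboration under the farm's budget. INTERFACE: the caller has built, for the top layer
`T = K_{n+t}`, the base `B = K_n ⊆ T` (`Bi`, with `[B : K] = p^n`), the `p`-Hilbert class field `H_p = HqF ⊆ H_T` of `T` as an intermediate
field over `T` (Galois over `B`, containing every `p`-power subextension of `H_T/T`, of degree `p^t·p^v` over `B`), the subgroup `A' = Gal(H_p/T)`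
of `G = Gal(H_p/B)` (given by its fixed elements) and the family `𝓘` of the inertia groups of the primes of `H_p` over `B`.  OUTPUT
(`exists_layer`): for `j ≤ t`, the subgroup `G_j = Gal(H_p/K_{n+j}) ≤ G` (image of restriction of scalars) contains `A'`, has index `p^j`, and its
norm group `N_j = G_j'·⟨I ∩ G_j : I ∈ 𝓘⟩` satisfies **`[G_j : N_j] = p^{e_{n+j}}`** (`e = ord_p h(K_{n+j})`; bricks (C), (D) of g19:
`index_dvd_classNumber_of_commutator_le_of_inertia_le`, `pow_padicValNat_classNumber_dvd_index_commutator_sup_inertia`) and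
**`[G_j : N_j·P_j] = p^{r_{n+j}}`** (`P_j` = `p`-th powers, `r = rank_p Cl(K_{n+j})`; rank bricks `index_sup_pow_dvd_index_range_pow`,
`index_range_pow_dvd_index_commutator_sup_inertia_sup_pow`), transported into `G` along the injection `Gal(H_p/K_{n+j}) ↪ Gal(H_p/K_n)`.

References: [Fukuda1994] Thm. 1, p. 264; [Washington1997] §13.3 Lemmas 13.15, 13.18, Prop. 13.22/13.23; [Lang1990] Ch. 3 §4, Ch. 13 §2;
[Cox2013] §5.C Cor. 5.24, §8.A Thm. 8.10.
-/

noncomputable section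

open scoped NumberField IsMulCommutative
open NumberField IsDedekindDomain Field IntermediateField

namespace Literature.NumberTheory.IwasawaTheory

open Literature.NumberTheory.EllipticCurves Literature.NumberTheory.GaloisRepresentations
  Literature.NumberTheory.NumberFields

variable {K : Type} [Field K] [NumberField K] {p : ℕ} [hp : Fact p.Prime]

/-- A subgroup containing the commutator subgroup is normal. [folklore] -/
private theorem normal_of_commutator_le {G : Type*} [Group G] {N : Subgroup G} (h : ⁅(⊤ : Subgroup G), ⊤⁆ ≤ N) :
    N.Normal :=
  ⟨fun m hm g => by
    have h2 := Subgroup.commutator_mem_commutator (Subgroup.mem_top g) (Subgroup.mem_top m)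
    rw [commutatorElement_def] at h2
    have h1 : g * m * g⁻¹ = g * m * g⁻¹ * m⁻¹ * m := by group
    rw [h1]
    exact mul_mem (h h2) hm⟩

/-- Brick (D) with the `M`-algebra structure of `Hq` as an explicit argument (as in `Fukuda1994Thm1Proofs`). [folklore] -/
private theorem dvd_index_of_algebra_eq (M F : Type) [Field M] [NumberField M] [Field F] [NumberField F] [Algebra M F]
    [IsGalois M F] (p : ℕ) [Fact p.Prime] (Hq : IntermediateField F (hilbertClassField F))
    (hmax : ∀ L : IntermediateField F (hilbertClassField F), (∃ k, Module.finrank F L = p ^ k) → L ≤ Hq)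
    (alg : Algebra M Hq) (halg : alg = IntermediateField.algebra' Hq) (hG : @IsGalois M _ (↥Hq) _ alg) :
    letI := alg
    p ^ padicValNat p (classNumber M) ∣
      (⁅(⊤ : Subgroup (Hq ≃ₐ[M] Hq)), ⊤⁆ ⊔ ⨆ (Q : MaximalSpectrum (𝓞 Hq)), Q.asIdeal.inertia (Hq ≃ₐ[M] Hq)).index ∧
    (powMonoidHom p : ClassGroup (𝓞 M) →* ClassGroup (𝓞 M)).range.index ∣
      ((⁅(⊤ : Subgroup (Hq ≃ₐ[M] Hq)), ⊤⁆ ⊔ ⨆ (Q : MaximalSpectrum (𝓞 Hq)), Q.asIdeal.inertia (Hq ≃ₐ[M] Hq)) ⊔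
        Subgroup.closure (Set.range fun σ : Hq ≃ₐ[M] Hq => σ ^ p)).index := by
  subst halg
  exact ⟨pow_padicValNat_classNumber_dvd_index_commutator_sup_inertia M F p Hq hmax,
    index_range_pow_dvd_index_commutator_sup_inertia_sup_pow M F p Hq hmax⟩

/-- `[Cl : Cl^p]` is invariant under isomorphism of class groups. [folklore] -/
private theorem index_range_pow_eq_of_mulEquiv {G H : Type*} [CommGroup G] [CommGroup H] (e : G ≃* H) (p : ℕ) :
    (powMonoidHom p : H →* H).range.index = (powMonoidHom p : G →* G).range.index := by
  have hmap : (powMonoidHom p : G →* G).range.map e.toMonoidHom = (powMonoidHom p : H →* H).range := by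
    ext h
    constructor
    · rintro ⟨x, ⟨y, rfl⟩, rfl⟩
      exact ⟨e y, by rw [powMonoidHom_apply, powMonoidHom_apply, MulEquiv.coe_toMonoidHom, map_pow]⟩
    · rintro ⟨y, rfl⟩
      refine ⟨e.symm y ^ p, ⟨e.symm y, rfl⟩, ?_⟩
      rw [powMonoidHom_apply, MulEquiv.coe_toMonoidHom, map_pow, MulEquiv.apply_symm_apply]
  rw [← hmap, Subgroup.index_map_of_bijective e.bijective]

set_option maxHeartbeats 40000000 in
set_option synthInstance.maxHeartbeats 400000 in
/-- **The layer `G_j = Gal(H_p/K_{n+j})` of `Gal(H_p/K_n)`: contains `A' = Gal(H_p/K_{n+t})`, has index `p^j`, `[G_j : N_j] = p^{e_{n+j}}` and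
`[G_j : N_j·P_j] = p^{r_{n+j}}`** (interface described in the module docstring; `v` is `ord_p h(K_{n+t})`, only `[H_p : K_n] = p^t·p^v` is used).
[cite: Washington1997, §13.3 Lemmas 13.15 and 13.18, Prop. 13.23] [cite: Fukuda1994, Thm. 1 (2), p. 264 (proof)] -/
theorem exists_layer (κ : ZpExtension K p) (n t j : ℕ) (hj : j ≤ t)
    [FiniteDimensional K (κ.layer (n + t))] [IsGalois K (κ.layer (n + t))] [NumberField (κ.layer (n + t))]
    (Bi : IntermediateField K (κ.layer (n + t))) (hBi : Bi = IntermediateField.restrict (κ.layer_mono (Nat.le_add_right n t)))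
    [FiniteDimensional K Bi] [IsGalois K Bi] [NumberField Bi] [IsGalois Bi (κ.layer (n + t))]
    (hdegKB : Module.finrank K Bi = p ^ n)
    [IsGalois Bi (hilbertClassField (κ.layer (n + t)))] [FiniteDimensional Bi (hilbertClassField (κ.layer (n + t)))]
    (HqF : IntermediateField (κ.layer (n + t)) (hilbertClassField (κ.layer (n + t))))
    [IsGalois Bi HqF] [FiniteDimensional Bi HqF] [NumberField HqF] [IsScalarTower Bi HqF (hilbertClassField (κ.layer (n + t)))]
    [IsGalois (κ.layer (n + t)) HqF] [IsUnramifiedAtInfinitePlaces Bi HqF] [IsScalarTower Bi (κ.layer (n + t)) HqF]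
    (hmax : ∀ L : IntermediateField (κ.layer (n + t)) (hilbertClassField (κ.layer (n + t))),
      (∃ k, Module.finrank (κ.layer (n + t)) L = p ^ k) → L ≤ HqF)
    (v : ℕ) (hdegHp : Module.finrank Bi HqF = p ^ t * p ^ v)
    (A' : Subgroup (HqF ≃ₐ[Bi] HqF))
    (hmemA' : ∀ g : HqF ≃ₐ[Bi] HqF, g ∈ A' ↔ ∀ x : (κ.layer (n + t)), g (algebraMap (κ.layer (n + t)) HqF x) = algebraMap (κ.layer (n + t)) HqF x)
    (𝓘 : Set (Subgroup (HqF ≃ₐ[Bi] HqF)))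
    (h𝓘def : 𝓘 = Set.range (fun Q : MaximalSpectrum (𝓞 HqF) => Q.asIdeal.inertia (HqF ≃ₐ[Bi] HqF))) :
    ∃ Gj : Subgroup (HqF ≃ₐ[Bi] HqF), A' ≤ Gj ∧ Gj.index = p ^ j ∧
      (⁅Gj, Gj⁆ ⊔ ⨆ I ∈ 𝓘, I ⊓ Gj).relIndex Gj = p ^ classNumberPExp κ (n + j) ∧
      ((⁅Gj, Gj⁆ ⊔ ⨆ I ∈ 𝓘, I ⊓ Gj) ⊔ Subgroup.closure ((fun x : HqF ≃ₐ[Bi] HqF => x ^ p) '' (Gj : Set (HqF ≃ₐ[Bi] HqF)))).relIndex Gj =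
        p ^ classGroupPRank κ (n + j) := by
  classical
  have hp0 : 0 < p := hp.out.pos
  haveI : FiniteDimensional K (κ.layer (n + j)) := κ.finiteDimensional_layer_holds (n + j)
  haveI : IsGalois K (κ.layer (n + j)) := κ.isGalois_layer_holds (n + j)
  haveI : NumberField (κ.layer (n + j)) := NumberField.of_module_finite K _
  have hBFj : κ.layer n ≤ κ.layer (n + j) := κ.layer_mono (Nat.le_add_right n j)
  have hFjF : κ.layer (n + j) ≤ κ.layer (n + t) := κ.layer_mono (by omega)
  obtain ⟨Fji, hFji⟩ : ∃ Fji : IntermediateField K (κ.layer (n + t)), Fji = IntermediateField.restrict hFjF := ⟨_, rfl⟩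
  have hBiFji : Bi ≤ Fji := by
    intro x hx
    rw [hBi, IntermediateField.mem_restrict] at hx
    rw [hFji, IntermediateField.mem_restrict]
    exact hBFj hx
  let eFj : (κ.layer (n + j)) ≃ₐ[K] Fji :=
    (IntermediateField.restrict_algEquiv hFjF).trans (IntermediateField.equivOfEq hFji.symm)
  obtain ⟨Fje, hFje⟩ : ∃ Fje : IntermediateField Bi (κ.layer (n + t)), Fje = IntermediateField.extendScalars hBiFji :=
    ⟨_, rfl⟩
  have hmemFje : ∀ x : (κ.layer (n + t)), x ∈ Fje ↔ x ∈ Fji := fun x => by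
    rw [hFje, IntermediateField.mem_extendScalars]
  let eFje : Fji ≃+* Fje :=
    { toFun := fun x => ⟨x, (hmemFje _).mpr x.2⟩
      invFun := fun x => ⟨x, (hmemFje _).mp x.2⟩
      left_inv := fun _ => rfl
      right_inv := fun _ => rfl
      map_mul' := fun _ _ => rfl
      map_add' := fun _ _ => rfl }
  haveI : FiniteDimensional K Fji := LinearEquiv.finiteDimensional eFj.toLinearEquiv
  haveI : IsGalois K Fji := IsGalois.of_algEquiv eFj
  haveI : NumberField Fji := NumberField.of_module_finite K _
  haveI hFjefd : FiniteDimensional K Fje := by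
    have : FiniteDimensional K (Fje.restrictScalars K) := by rw [hFje, IntermediateField.extendScalars_restrictScalars]; infer_instance
    exact this
  haveI : IsGalois K Fje := by
    have : IsGalois K (Fje.restrictScalars K) := by rw [hFje, IntermediateField.extendScalars_restrictScalars]; infer_instance
    exact this
  haveI : NumberField Fje := NumberField.of_module_finite K _
  haveI : IsGalois Bi Fje := IsGalois.tower_top_of_isGalois K Bi Fje
  haveI : IsScalarTower K Fje (κ.layer (n + t)) := IsScalarTower.of_algebraMap_eq fun _ => rfl
  haveI : IsGalois Fje (κ.layer (n + t)) := IsGalois.tower_top_of_isGalois K Fje (κ.layer (n + t))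
  -- scalar towers for `HqF` and `H_T` over `F_j`
  haveI : IsScalarTower K Fje (hilbertClassField (κ.layer (n + t))) := IsScalarTower.of_algebraMap_eq fun _ => rfl
  haveI : IsGalois Fje (hilbertClassField (κ.layer (n + t))) := IsGalois.tower_top_of_isGalois Bi Fje (hilbertClassField (κ.layer (n + t)))
  haveI : IsScalarTower Bi Fje HqF := IsScalarTower.of_algebraMap_eq fun _ => rfl
  haveI : IsScalarTower Fje HqF (hilbertClassField (κ.layer (n + t))) := IsScalarTower.of_algebraMap_eq fun _ => rfl
  haveI : IsScalarTower K Fje HqF := IsScalarTower.of_algebraMap_eq fun _ => rfl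
  haveI : IsGalois Fje HqF := IsGalois.tower_top_of_isGalois Bi Fje HqF
  haveI : IsUnramifiedAtInfinitePlaces Fje HqF := IsUnramifiedAtInfinitePlaces.top (k := Bi) (K := Fje) (F := HqF)
  haveI : Module.Free Fje HqF := Module.Free.of_divisionRing Fje HqF
  haveI : Module.Free Bi Fje := Module.Free.of_divisionRing Bi Fje
  haveI : Module.Free Bi HqF := Module.Free.of_divisionRing Bi HqF
  -- degrees
  have hdegBFj : Module.finrank Bi Fje = p ^ j := by
    have h := Module.finrank_mul_finrank K Bi Fje
    have h2 : Module.finrank K Fje = p ^ (n + j) := by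
      have : Module.finrank K (Fje.restrictScalars K) = Module.finrank K Fji := by
        rw [hFje, IntermediateField.extendScalars_restrictScalars]
      rw [← κ.finrank_layer_holds (n + j), eFj.toLinearEquiv.finrank_eq, ← this]; rfl
    rw [hdegKB, h2, pow_add] at h
    exact Nat.eq_of_mul_eq_mul_left (pow_pos hp0 n) h
  have hGpcard : Nat.card (HqF ≃ₐ[Bi] HqF) = p ^ t * p ^ v := by rw [IsGalois.card_aut_eq_finrank, hdegHp]
  -- class group transport `Cl(F_j) ≅ Cl(K_{n+j})`
  have eCl : ClassGroup (𝓞 (κ.layer (n + j))) ≃* ClassGroup (𝓞 Fje) :=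
    ClassGroup.mulEquiv (RingOfIntegers.mapRingEquiv (eFj.toRingEquiv.trans eFje))
  have hclFj : padicValNat p (classNumber Fje) = classNumberPExp κ (n + j) := by
    rw [classNumberPExp_eq_padicValNat_classNumber]
    congr 1
    exact (Fintype.card_congr eCl.toEquiv).symm
  have hrkFj : (powMonoidHom p : ClassGroup (𝓞 Fje) →* ClassGroup (𝓞 Fje)).range.index =
      (powMonoidHom p : ClassGroup (𝓞 (κ.layer (n + j))) →* ClassGroup (𝓞 (κ.layer (n + j)))).range.index :=
    index_range_pow_eq_of_mulEquiv eCl p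
  -- class field theory over `F_j` (bricks (C), (D) and their rank forms)
  obtain ⟨hD, hDr⟩ := dvd_index_of_algebra_eq Fje (κ.layer (n + t)) p HqF hmax inferInstance (Algebra.algebra_ext _ _ fun _ => rfl)
    inferInstance
  -- the Galois group `G_j = Gal(H_p/F_j)` as the image of restriction of scalars
  let ρj : (HqF ≃ₐ[Fje] HqF) →* (HqF ≃ₐ[Bi] HqF) :=
    { toFun := fun σ => σ.restrictScalars Bi
      map_one' := rfl
      map_mul' := fun _ _ => rfl }
  have hρj_inj : Function.Injective ρj := fun σ τ h => AlgEquiv.restrictScalars_injective Bi h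
  obtain ⟨Gj, hGj⟩ : ∃ Gj : Subgroup (HqF ≃ₐ[Bi] HqF), Gj = ρj.range := ⟨_, rfl⟩
  have hGjcard' : Nat.card (HqF ≃ₐ[Fje] HqF) * p ^ j = p ^ t * p ^ v := by
    have h1 := Module.finrank_mul_finrank Bi Fje HqF
    rw [hdegBFj, hdegHp] at h1
    rw [IsGalois.card_aut_eq_finrank, mul_comm]
    exact h1
  have hGjindex : Gj.index = p ^ j := by
    rw [hGj]
    have h1 := ρj.range.index_mul_card
    rw [← Nat.card_congr (MonoidHom.ofInjective hρj_inj).toEquiv, hGpcard, ← hGjcard', mul_comm] at h1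
    exact Nat.eq_of_mul_eq_mul_left Nat.card_pos h1
  have hA'Gj : A' ≤ Gj := by
    intro x hx
    rw [hGj]
    exact ⟨{ x with commutes' := fun y => (hmemA' x).mp hx (y : κ.layer (n + t)) }, AlgEquiv.ext fun _ => rfl⟩
  -- the norm group `N_j ≤ Gal(H_p/F_j)` and its `p`-power companion: indices `p^{e_{n+j}}`, `p^{r_{n+j}}`
  obtain ⟨Nj, hNj⟩ : ∃ Nj : Subgroup (HqF ≃ₐ[Fje] HqF), Nj =
      ⁅(⊤ : Subgroup (HqF ≃ₐ[Fje] HqF)), ⊤⁆ ⊔ ⨆ (Q : MaximalSpectrum (𝓞 HqF)), Q.asIdeal.inertia (HqF ≃ₐ[Fje] HqF) :=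
    ⟨_, rfl⟩
  haveI hNjn : Nj.Normal := by rw [hNj]; exact normal_of_commutator_le le_sup_left
  have hIN : ∀ (Q : Ideal (𝓞 HqF)) [Q.IsMaximal], Q.inertia (HqF ≃ₐ[Fje] HqF) ≤ Nj := fun Q _ => by
    rw [hNj]
    exact le_sup_of_le_right
      (le_iSup (fun Q : MaximalSpectrum (𝓞 HqF) => Q.asIdeal.inertia (HqF ≃ₐ[Fje] HqF)) ⟨Q, ‹_›⟩)
  have hCj : Nj.index ∣ classNumber Fje :=
    index_dvd_classNumber_of_commutator_le_of_inertia_le Fje HqF Nj (by rw [hNj]; exact le_sup_left) hIN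
  have hCjr : (Nj ⊔ Subgroup.closure (Set.range fun σ : HqF ≃ₐ[Fje] HqF => σ ^ p)).index ∣
      (powMonoidHom p : ClassGroup (𝓞 Fje) →* ClassGroup (𝓞 Fje)).range.index :=
    index_sup_pow_dvd_index_range_pow Fje HqF Nj (by rw [hNj]; exact le_sup_left) hIN p
  have hclFjne : classNumber Fje ≠ 0 := Fintype.card_ne_zero
  have hNjindex : Nj.index = p ^ padicValNat p (classNumber Fje) := by
    have hGjcard : Nat.card (HqF ≃ₐ[Fje] HqF) = p ^ (t - j) * p ^ v := by
      have h1 := hGjcard'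
      rw [← pow_sub_mul_pow p hj, mul_comm (p ^ (t - j)) (p ^ j), mul_assoc] at h1
      exact Nat.eq_of_mul_eq_mul_left (pow_pos hp0 j) (by rw [mul_comm] at h1; exact h1)
    obtain ⟨i, -, hi⟩ := (Nat.dvd_prime_pow hp.out).mp ((hGjcard.trans (pow_add p _ _).symm) ▸ Nj.index_dvd_card)
    rw [hi] at hCj ⊢
    have hDj : p ^ padicValNat p (classNumber Fje) ∣ p ^ i := by rw [← hi, hNj]; exact hD
    have h1 : padicValNat p (classNumber Fje) ≤ i := (Nat.pow_dvd_pow_iff_le_right hp.out.one_lt).mp hDj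
    have h2 : i ≤ padicValNat p (classNumber Fje) := (padicValNat_dvd_iff_le hclFjne).mp hCj
    congr 1
    omega
  have hNjrindex : (Nj ⊔ Subgroup.closure (Set.range fun σ : HqF ≃ₐ[Fje] HqF => σ ^ p)).index =
      (powMonoidHom p : ClassGroup (𝓞 Fje) →* ClassGroup (𝓞 Fje)).range.index :=
    Nat.dvd_antisymm hCjr (by rw [hNj]; exact hDr)
  -- transport along `ρj`
  have hmapI : ∀ Q : MaximalSpectrum (𝓞 HqF),
      (Q.asIdeal.inertia (HqF ≃ₐ[Fje] HqF)).map ρj = Q.asIdeal.inertia (HqF ≃ₐ[Bi] HqF) ⊓ ρj.range := by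
    intro Q
    ext x
    constructor
    · rintro ⟨σ, hσ, rfl⟩
      exact ⟨fun y => hσ y, ⟨σ, rfl⟩⟩
    · rintro ⟨hgI, ⟨σ, rfl⟩⟩
      exact ⟨σ, fun y => hgI y, rfl⟩
  have hmapN : Nj.map ρj = ⁅Gj, Gj⁆ ⊔ ⨆ I ∈ 𝓘, I ⊓ Gj := by
    rw [hGj, hNj, Subgroup.map_sup, Subgroup.map_commutator, ← MonoidHom.range_eq_map, Subgroup.map_iSup, h𝓘def,
      iSup_range]
    simp_rw [hmapI]
  have hmapP : (Subgroup.closure (Set.range fun σ : HqF ≃ₐ[Fje] HqF => σ ^ p)).map ρj =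
      Subgroup.closure ((fun x : HqF ≃ₐ[Bi] HqF => x ^ p) '' (Gj : Set (HqF ≃ₐ[Bi] HqF))) := by
    rw [MonoidHom.map_closure]
    congr 1
    ext x
    constructor
    · rintro ⟨_, ⟨σ, rfl⟩, rfl⟩
      exact ⟨ρj σ, by rw [hGj]; exact ⟨σ, rfl⟩, by rw [map_pow]⟩
    · rintro ⟨y, hy, rfl⟩
      rw [hGj] at hy
      obtain ⟨σ, rfl⟩ := hy
      exact ⟨σ ^ p, ⟨σ, rfl⟩, by rw [map_pow]⟩
  have hrel : (⁅Gj, Gj⁆ ⊔ ⨆ I ∈ 𝓘, I ⊓ Gj).relIndex Gj = Nj.index := by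
    rw [← hmapN, hGj, MonoidHom.range_eq_map, Subgroup.relIndex_map_map_of_injective Nj ⊤ hρj_inj, Subgroup.relIndex_top_right]
  have hrelr : ((⁅Gj, Gj⁆ ⊔ ⨆ I ∈ 𝓘, I ⊓ Gj) ⊔
      Subgroup.closure ((fun x : HqF ≃ₐ[Bi] HqF => x ^ p) '' (Gj : Set (HqF ≃ₐ[Bi] HqF)))).relIndex Gj =
      (Nj ⊔ Subgroup.closure (Set.range fun σ : HqF ≃ₐ[Fje] HqF => σ ^ p)).index := by
    rw [← hmapN, ← hmapP, ← Subgroup.map_sup, hGj, MonoidHom.range_eq_map, Subgroup.relIndex_map_map_of_injective _ ⊤ hρj_inj,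
      Subgroup.relIndex_top_right]
  refine ⟨Gj, hA'Gj, hGjindex, ?_, ?_⟩
  · rw [hrel, hNjindex, hclFj]
  · rw [hrelr, hNjrindex, hrkFj]
    obtain ⟨c, hc⟩ := index_range_powMonoidHom_eq_prime_pow (K := ↥(κ.layer (n + j))) p
    unfold classGroupPRank
    rw [← Subgroup.index_eq_card, hc, padicValNat.prime_pow]

end Literature.NumberTheory.IwasawaTheory

end
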